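import Mathlib
import Summits.ResolutionOfSingularities.ResolutionOfSingularities.Theorems.SandwichedSingularitiesResolution
import Summits.ResolutionOfSingularities.ResolutionOfSingularities.Theorems.ValuativePatchingRelLocalRegLeificationWeak
import Summits.ResolutionOfSingularities.ResolutionOfSingularities.Theorems.ValuativePatchingRelRegLeificationOfSandwichedLocus
import Literature.AlgebraicGeometry.Resolution.SandwichedWeakPatching
import Literature.AlgebraicGeometry.Resolution.ProperModelsPatchingGluing
import Literature.AlgebraicGeometry.Resolution.LocalRegLeificationOfSandwiched
import Literature.AlgebraicGeometry.Resolution.ProperModelsExtension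
import Literature.AlgebraicGeometry.Resolution.ProperModelsRegLeification
import Literature.AlgebraicGeometry.Morphisms.OpenGluingProofs
import Literature.AlgebraicGeometry.Morphisms.NagataCompactification
import Literature.AlgebraicGeometry.Morphisms.ProperOpenPieceCartesian
import HarnessLib

/-!
# ResolutionOfSingularities / Valuative — crux `PatchingRel`, line `sandwiched-gluing`:
# bridges between the atoms SAND⁺ (gen 0), SANDʷ and SANDᴸ (gen 1)

Crux `stmt-ResolutionOfSingularities-0642`, line `sandwiched-gluing`. The gen-0 cut used the STRONG
atom `SandwichedStrongResolution p` (strong resolution of the sandwiched piece `V`, an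
isomorphism over `Reg V`) with two-piece gluing and Nagata compactification; the gen-1 cut uses
SANDᴸ (`SandwichedLocusResolution p`, resolution over a sandwiched-singularity open), whose
absolute form is SANDʷ (`SandwichedSingularitiesResolution p`). Proved here:

* `sandwichedSingularitiesResolution_of_openGluing_of_strong`, `…_of_strong` —
  `OpenGluing → SAND⁺(p) → SANDʷ(p)` (the gen-0 gluing `exists_localRegLeification_data` applied to
  `X` itself; `OpenGluing_holds` discharges the gluing);
* `sandwichedLocusResolution_of_nagata_of_sandwichedWeak` — `Nagata → SANDʷ(p) → SANDᴸ(p)`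
  (resolve the open, extend by `exists_isPullback_of_nagata`); hence
  `sandwichedLocusResolution_of_nagata_of_strong` — `Nagata → SAND⁺(p) → SANDᴸ(p)`.

* `sandwichedLocusResolution_of_nagata_of_twoModelPatching`, `sandwichedLocusResolution_iff_twoModelPatching`
  — `Nagata → (SANDᴸ(p) ↔ ProperModel.TwoModelPatching p)`: unconditionally SANDᴸ ⇒ RegLe-ification
  ⇒ two-model patching (`stub_regLeification_of_sandwichedLocus`,
  `SandwichedGluing.twoModelPatching_of_regLeification`); conversely two-model patching ⇒ SANDʷ
  (the refuter's costume theorem `sandwichedWeakResolution_of_twoModelPatching`,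
  `SandwichedWeakPatching.lean`, modulo Nagata) ⇒ SANDᴸ (modulo Nagata). So, modulo Nagata, the
  open core of the crux has four equivalent costumes {SANDᴸ, SANDʷ, RegLeification, TMP}; SANDᴸ is
  the one for which `PatchingRel ↔ ∀ p prime, (LUrel_p → ·)` needs no compactification theorem.

So the gen-1 atom is implied by the gen-0 inputs: nothing built in gen 0 is lost.

## References

* B. Conrad, *Deligne's notes on Nagata compactifications*, J. Ramanujan Math. Soc. 22 (2007),
  Thm. 4.1. [Conrad2007]
* O. Piltant, *An axiomatic version of Zariski's patching theorem*, RACSAM 107 (2013) 91–121,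
  proof of Prop. 5.1, Step 5. [Piltant2013]
* The Stacks Project, Tag 01LH. [StacksProject]
-/

-- `Summit.<Summit>.<Sub>[.Theorems]` with `Sub = Summit` (single-conjunct summit, D-0017): the duplicated
-- namespace component is the tree layout.
set_option linter.dupNamespace false

noncomputable section

namespace Summit.ResolutionOfSingularities.ResolutionOfSingularities.Theorems

open CategoryTheory AlgebraicGeometry TopologicalSpace Topology
open Literature.AlgebraicGeometry.Resolution Literature.AlgebraicGeometry.Morphisms

universe u

/-- **`OpenGluing` + SAND⁺(p) ⇒ SANDʷ(p)**: the gen-1 absolute atom is weaker than the gen-0 one.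
Given the datum of SANDʷ (`X` regular off the open `V`, `η : V → U` proper birational over the
regular `U`), SAND⁺ gives a strong resolution `π : Yv → V` (an isomorphism over `Reg V`), and
gluing it to `X ∖ closure (Sing V)` along `Reg V` (`exists_localRegLeification_data`) gives a
proper birational `N → O` onto an open `O ⊇ Reg X ∪ V = X`, regular over `Reg X` and over `V`,
i.e. a resolution of `X`. [folklore] -/
theorem sandwichedSingularitiesResolution_of_openGluing_of_strong (p : ℕ) (hOG : OpenGluing.{u})
    (hS : SandwichedStrongResolution.{u} p) : SandwichedSingularitiesResolution.{u} p := by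
  intro k _ _ U X f g V η _ _ _ _ hU _ _ _ _ hη hbir _ hout
  -- if `V = ∅` then `X` is regular
  by_cases hVne : (V : Set X).Nonempty
  swap
  · refine Scheme.IsRegular.hasResolution fun x => hout x fun hx => hVne ⟨x, hx⟩
  haveI : Nonempty (V : Scheme.{u}) := by
    obtain ⟨x, hx⟩ := hVne
    exact ⟨⟨x, hx⟩⟩
  haveI : IsIntegral (V : Scheme.{u}) := isIntegral_of_isOpenImmersion V.ι
  haveI := hη
  -- SAND⁺ on `V → U`
  obtain ⟨Yv, π, hres, W, hW, hπW⟩ := hS k U (V : Scheme.{u}) f η ‹_› ‹_› ‹_› ‹_› hU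
    inferInstance hη hbir
  haveI := hres.isProper
  haveI := hπW
  haveI : IsIntegral Yv := by
    haveI := hres.isRegular.isReduced
    exact hres.isBirational.isIntegral
  -- glue to `X ∖ closure (Sing V)`
  obtain ⟨O, N, ρ, hN, hρ, hρbir, hRegO, hVO, h6, h7⟩ :=
    exists_localRegLeification_data hOG (isOpen_regularLocus_of_locallyOfFiniteType_field g)
      V π hres.isRegular W hW
  -- `O = ⊤`: every point is regular or in `V`
  have hO : O = ⊤ := by
    refine top_le_iff.mp fun x _ => ?_
    by_cases hx : x ∈ V
    · exact hVO hx
    · exact hRegO ((Scheme.mem_regularLocus x).mpr (hout x hx))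
  -- `N` is regular: each point lies over `V` or over `Reg X`
  have hNreg : Scheme.IsRegular N := by
    intro n
    by_cases hn : (ρ n).1 ∈ V
    · exact h7 n hn
    · exact h6 n (hout _ hn)
  haveI := hρ
  have hO' : Scheme.HasResolution (O : Scheme.{u}) := ⟨N, ρ, ⟨hρ, hρbir, hNreg⟩⟩
  -- transport along `O = ⊤ ≅ X`
  haveI : IsIso O.ι := by
    rw [hO, ← Scheme.topIso_hom]
    infer_instance
  exact Scheme.HasResolution.of_isBirational O.ι (isBirational_of_isIso O.ι) hO'

/-- SAND⁺(p) ⇒ SANDʷ(p) outright, the two-piece gluing fact being a theorem (`OpenGluing_holds`).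
[folklore] -/
theorem sandwichedSingularitiesResolution_of_strong (p : ℕ)
    (hS : SandwichedStrongResolution.{u} p) : SandwichedSingularitiesResolution.{u} p :=
  sandwichedSingularitiesResolution_of_openGluing_of_strong p OpenGluing_holds hS

/-- **Nagata compactification + SANDʷ(p) ⇒ SANDᴸ(p)**: resolve the sandwiched-singularity open
`O` of `M` by SANDʷ (`hasResolution_opens_of_sandwichedWeak`), then extend the resolution
`N₀ → O` to an integral proper `ρ : Z → M` with `Z ×_M O = N₀` by Nagata's theorem
(`exists_isPullback_of_nagata`); `ρ` is an isomorphism over the image of the iso-locus of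
`N₀ → O`, hence birational, and its points over `O` are points of the regular `N₀`.
[cite: Conrad2007, Thm. 4.1 (use)] -/
theorem sandwichedLocusResolution_of_nagata_of_sandwichedWeak (p : ℕ)
    (hN : NagataCompactification.{u}) (hS : SandwichedSingularitiesResolution.{u} p) :
    SandwichedLocusResolution.{u} p := by
  intro k _ _ U M f g O V η hf₁ hf₂ hf₃ hU hUreg hg₁ hg₂ hg₃ hM hη hbir hcompat hVO hout
  haveI := hf₁; haveI := hf₂; haveI := hf₃; haveI := hU; haveI := hg₁; haveI := hg₂
  haveI := hg₃; haveI := hM; haveI := hη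
  haveI : IsLocallyNoetherian M := LocallyOfFiniteType.isLocallyNoetherian g
  haveI : CompactSpace M := QuasiCompact.compactSpace_of_compactSpace g
  haveI : IsNoetherian M := {}
  by_cases hO : (O : Set M).Nonempty
  swap
  · -- `O = ∅`: the identity does it
    exact ⟨M, 𝟙 M, inferInstance, inferInstance, isBirational_of_isIso (𝟙 M),
      fun n hn => absurd ⟨_, hn⟩ hO⟩
  haveI : Nonempty (O : Scheme.{u}) := by
    obtain ⟨x, hx⟩ := hO
    exact ⟨⟨x, hx⟩⟩
  -- resolve `O` by SANDʷ
  obtain ⟨N₀, π, hres⟩ :=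
    hasResolution_opens_of_sandwichedWeak p hS f g hUreg O V η hbir hcompat hVO hout
  haveI := hres.isProper
  haveI : IsIntegral N₀ := by
    haveI := hres.isRegular.isReduced
    exact hres.isBirational.isIntegral
  -- extend over `M` by Nagata
  obtain ⟨Z, ρ, s, hZ, hρ, hs, -, hsq⟩ := exists_isPullback_of_nagata hN O π
  haveI := hZ
  haveI := hρ
  haveI := hs
  -- `ρ` is an isomorphism over the image of the iso-locus of `π`, hence birational
  obtain ⟨O', hO'd, -, hO'iso⟩ := hres.isBirational
  haveI := hO'iso
  haveI hW : IsIso (ρ ∣_ (O.ι ''ᵁ O')) := isIso_morphismRestrict_image_of_isPullback hsq O'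
  have hWne : (O.ι ''ᵁ O' : Set M).Nonempty := nonempty_image_ι O hO'd.nonempty
  have hbirρ : IsBirational ρ := by
    refine ⟨O.ι ''ᵁ O', (O.ι ''ᵁ O').2.dense hWne, (ρ ⁻¹ᵁ (O.ι ''ᵁ O')).2.dense ?_, hW⟩
    obtain ⟨x, hx⟩ := hWne
    let z := (Scheme.homeoOfIso (asIso (ρ ∣_ (O.ι ''ᵁ O')))).symm ⟨x, hx⟩
    exact ⟨z.1, z.2⟩
  -- points of `Z` over `O` are points of the regular `N₀`
  refine ⟨Z, ρ, hZ, hρ, hbirρ, fun n hn => ?_⟩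
  exact isRegularLocalRing_stalk_of_isPullback_ι hsq (S := (O : Set M)) le_rfl
    (fun m _ => hres.isRegular m) n hn

/-- Hence **Nagata compactification + SAND⁺(p) ⇒ SANDᴸ(p)**: the gen-0 atom (with the classical
compactification theorem) gives the gen-1 atom. [cite: Conrad2007, Thm. 4.1 (use)] -/
theorem sandwichedLocusResolution_of_nagata_of_strong (p : ℕ) (hN : NagataCompactification.{u})
    (hS : SandwichedStrongResolution.{u} p) : SandwichedLocusResolution.{u} p :=
  sandwichedLocusResolution_of_nagata_of_sandwichedWeak p hN
    (sandwichedSingularitiesResolution_of_strong p hS)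

/-- **SANDᴸ(p) ⇒ two-model patching of proper models**, unconditionally (RegLe-ification from
SANDᴸ, then RegLe-ification twice on the join). [cite: Piltant2013, Prop. 5.1] -/
theorem twoModelPatching_of_sandwichedLocusResolution (p : ℕ)
    (hS : SandwichedLocusResolution.{u} p) : ProperModel.TwoModelPatching.{u} p :=
  SandwichedGluing.twoModelPatching_of_regLeification p
    (regLeification_of_sandwichedLocusResolution p hS)

/-- **Nagata compactification + two-model patching ⇒ SANDᴸ(p)**: two-model patching gives the
Literature transcription of SANDʷ (`sandwichedWeakResolution_of_twoModelPatching`, the refuter's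
costume theorem), hence SANDʷ, hence SANDᴸ by the Nagata bridge.
[cite: Piltant2013, Prop. 5.1 (shape of two-model patching)] -/
theorem sandwichedLocusResolution_of_nagata_of_twoModelPatching (p : ℕ)
    (hN : NagataCompactification.{u}) (hT : ProperModel.TwoModelPatching.{u} p) :
    SandwichedLocusResolution.{u} p :=
  sandwichedLocusResolution_of_nagata_of_sandwichedWeak p hN
    (sandwichedSingularitiesResolution_of_sandwichedWeakResolution
      (sandwichedWeakResolution_of_twoModelPatching hN hT))

/-- **Modulo Nagata compactification, SANDᴸ(p) ⟺ two-model patching of proper models in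
characteristic `p`** (Piltant 2013, Prop. 5.1 with `P = P_reg`; open in dimension `≥ 4`): the
open core of the crux `PatchingRel` in its scheme-theoretic and in its model-theoretic costume.
[cite: Piltant2013, p. 2 and Prop. 5.1] -/
theorem sandwichedLocusResolution_iff_twoModelPatching (p : ℕ) (hN : NagataCompactification.{u}) :
    SandwichedLocusResolution.{u} p ↔ ProperModel.TwoModelPatching.{u} p :=
  ⟨twoModelPatching_of_sandwichedLocusResolution p,
    sandwichedLocusResolution_of_nagata_of_twoModelPatching p hN⟩

/-- Likewise SANDᴸ(p) ⟺ SANDʷ(p) modulo Nagata compactification. [folklore] -/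
theorem sandwichedLocusResolution_iff_sandwichedSingularitiesResolution (p : ℕ)
    (hN : NagataCompactification.{u}) :
    SandwichedLocusResolution.{u} p ↔ SandwichedSingularitiesResolution.{u} p :=
  ⟨sandwichedSingularitiesResolution_of_sandwichedLocus,
    sandwichedLocusResolution_of_nagata_of_sandwichedWeak p hN⟩

/-- **Registered stub of line `sandwiched-gluing`** (universe `0`): Nagata compactification +
SANDʷ(p) ⇒ SANDᴸ(p). [cite: Conrad2007, Thm. 4.1 (use)] -/
theorem stub_sandwichedLocus_of_nagata_of_sandwichedWeak :
    ∀ p : ℕ, NagataCompactification.{0} → SandwichedSingularitiesResolution.{0} p →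
      SandwichedLocusResolution.{0} p :=
  fun p hN hS => sandwichedLocusResolution_of_nagata_of_sandwichedWeak p hN hS

end Summit.ResolutionOfSingularities.ResolutionOfSingularities.Theorems


end
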